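/-
Copyright (c) 2026 the pub-hodgecm-mathlib formalisation cell (harness21).  Prover seat hodgecm-mathlib-K2E3-p17 (g8), Track B «K2-LIT» ∕ h413
(`stmt-HodgeConjecture-24833`), line `K2_E3_EllipticInputs`, leaf (nsc-S-A′), D94 brick EXT (CENSUS v0.2 §7): twisted-coinvariant vanishing is closed under extensions.  2026-09-04.
-/
import Summits.HodgeConjecture.HodgeConjecture.Theorems.K2E3DegenerateSubquotientHeredity   -- ★ HER (this seat): `exists_coinvariantsMap_charTwist`, quotient ∕ surjection transport
import Summits.HodgeConjecture.HodgeConjecture.Theorems.K2E3GL2JacquetProdRep               -- ★ PEEL file 1 (K2E3-p25): `exact_of_mk_comp` (middle exactness of coinvariants)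
import HarnessLib

/-!
# Crux `H413` — leaf (nsc-S-A′), brick EXT: `r_{H,θ}(N) = 0` AND `r_{H,θ}(ρ ⁄ N) = 0` IMPLY `r_{H,θ}(ρ) = 0`

Cell `hodgecm-mathlib`, Track B; THEOREMS ONLY; count-neutral helper (`--supports stmt-HodgeConjecture-24833 --as helper`).

For a representation `ρ` of `G` on `V` (any commutative ring `k`), a subgroup `H ≤ G`, a character `θ : H → kˣ` and a subrepresentation `N ≤ ρ`: the `(H,θ)`-coinvariants are
right exact and exact in the middle along `0 → N → ρ → ρ ⁄ N → 0` (★ `exact_of_mk_comp` applied to the `θ`-twisted restrictions, whose maps are ★ HER's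
`exists_coinvariantsMap_charTwist`), so **`forall_mk_charTwist_eq_zero_of_extension`**: if every class vanishes in `r_{H,θ}(N)` and in `r_{H,θ}(ρ ⁄ N)` then every class
vanishes in `r_{H,θ}(ρ)`.  Specialisation `forall_mk_whittakerTwist_eq_zero_of_extension` (`H = U_n`, `θ = ψ_U`: `J_ψ(N) = 0 ∧ J_ψ(ρ⁄N) = 0 ⇒ J_ψ(ρ) = 0`), and the
two-step form `forall_mk_whittakerTwist_eq_zero_of_two_step` (`K₂ ≤ K₁ ≤ ρ` read through `K₁`).  USE (IRR″ ∕ NYA of CENSUS v0.2): the `GL₂`-part of `r_Q ω` is a successive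
extension of copies of `η∘det` (★ S2 PEEL-LINKED), each with `J_ψ = 0` (★ S1b), hence has `J_ψ = 0`, and ★ S3 makes `ω` `θ‴`-degenerate.

HONEST LABEL: HC_CM is proved only modulo the 7 printed citations (2 remaining named inputs: hLiu418 = stmt-HodgeConjecture-24832, h413 =
stmt-HodgeConjecture-24833) until rung 0 closes; count-neutral helper.

## References
* [BernsteinZelevinskyASENS1977] I. N. Bernstein, A. V. Zelevinsky, *Induced representations of reductive p-adic groups I*, Ann. Sci. ÉNS 10 (1977), §1.8 (b), Prop. 1.9 (a)–(b).
-/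

set_option autoImplicit false
-- the mandated namespace repeats `HodgeConjecture.HodgeConjecture`, as in every `Theorems/*.lean` of this sub-problem
set_option linter.dupNamespace false

noncomputable section

open Representation Literature.NumberTheory.Automorphic Literature.RepresentationTheory.FiniteGroups
open scoped MatrixGroups
open Summit.HodgeConjecture.HodgeConjecture.Cruxes.H413.K2E3DegenerateSubquotientHeredity (exists_coinvariantsMap_charTwist)
open Summit.HodgeConjecture.HodgeConjecture.Cruxes.H413.K2E3GL2JacquetProdRep (exact_of_mk_comp)

namespace Summit.HodgeConjecture.HodgeConjecture.Cruxes.H413.K2E3TwistedCoinvariantsExtension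

section General

variable {k G : Type*} [CommRing k] [Group G] {H : Subgroup G} {θ : ↥H →* kˣ} {V : Type*} [AddCommGroup V] [Module k V] (ρ : Representation k G V)

/-- **MIDDLE EXACTNESS of `r_{H,θ}` along `0 → N → ρ → ρ ⁄ N → 0`**: there are the two induced maps `[v] ↦ [v]` and `[v] ↦ [v̄]`, exact at `r_{H,θ}(ρ)`.
[cite: BernsteinZelevinskyASENS1977, Prop. 1.9 (a)–(b)] -/
theorem exists_exact_coinvariants_charTwist (N : Subrepresentation ρ) :
    ∃ (j₁ : (N.toRepresentation.charTwist H θ).Coinvariants →ₗ[k] (ρ.charTwist H θ).Coinvariants)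
      (j₂ : (ρ.charTwist H θ).Coinvariants →ₗ[k] (N.quotientRep.charTwist H θ).Coinvariants),
      (∀ v, j₁ (Coinvariants.mk _ v) = Coinvariants.mk _ (v : V)) ∧ (∀ v, j₂ (Coinvariants.mk _ v) = Coinvariants.mk _ (N.mkQ v)) ∧ Function.Exact j₁ j₂ := by
  let ι : N.toRepresentation.IntertwiningMap ρ := ⟨N.toSubmodule.subtype, fun _ => rfl⟩
  obtain ⟨F₁, hF₁, hF₁mk⟩ := exists_coinvariantsMap_charTwist (ρ₁ := N.toRepresentation) (ρ₂ := ρ) (H := H) (θ := θ) ι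
  obtain ⟨F₂, hF₂, hF₂mk⟩ := exists_coinvariantsMap_charTwist (ρ₁ := ρ) (ρ₂ := N.quotientRep) (H := H) (θ := θ) N.mkQ
  refine ⟨Coinvariants.map _ _ F₁, Coinvariants.map _ _ F₂, fun v => hF₁mk v, fun v => hF₂mk v, ?_⟩
  refine exact_of_mk_comp (N.toRepresentation.charTwist H θ) (ρ.charTwist H θ) (N.quotientRep.charTwist H θ) N.toSubmodule.subtype F₂ ?_ ?_ _ _
    (fun v => hF₁mk v) (fun v => by rw [hF₂mk, hF₂])
  · intro v
    rw [hF₂]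
    change N.toSubmodule.mkQ v = 0 ↔ v ∈ Set.range N.toSubmodule.subtype
    rw [Submodule.mkQ_apply, Submodule.Quotient.mk_eq_zero, Set.mem_range]
    exact ⟨fun hv => ⟨⟨v, hv⟩, rfl⟩, by rintro ⟨w, rfl⟩; exact w.2⟩
  · intro w
    obtain ⟨v, rfl⟩ := N.mkQ_surjective w
    exact ⟨v, hF₂ v⟩

/-- **`r_{H,θ}`-VANISHING IS CLOSED UNDER EXTENSIONS**: if every class vanishes in `r_{H,θ}(N)` and in `r_{H,θ}(ρ ⁄ N)`, then every class vanishes in `r_{H,θ}(ρ)`.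
[cite: BernsteinZelevinskyASENS1977, Prop. 1.9 (a)–(b)] -/
theorem forall_mk_charTwist_eq_zero_of_extension (N : Subrepresentation ρ)
    (hN : ∀ v, Coinvariants.mk (N.toRepresentation.charTwist H θ) v = 0) (hQ : ∀ w, Coinvariants.mk (N.quotientRep.charTwist H θ) w = 0) (v : V) :
    Coinvariants.mk (ρ.charTwist H θ) v = 0 := by
  obtain ⟨j₁, j₂, hj₁, hj₂, hex⟩ := exists_exact_coinvariants_charTwist (H := H) (θ := θ) ρ N
  have h2 : j₂ (Coinvariants.mk (ρ.charTwist H θ) v) = 0 := by rw [hj₂, hQ]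
  obtain ⟨c, hc⟩ := (hex _).1 h2
  obtain ⟨u, rfl⟩ := Coinvariants.mk_surjective _ c
  rw [← hc, hN, map_zero]

/-- Two-step form: `K₂ ≤ K₁` subrepresentations of `ρ` (as `K₂' ≤ K₁.toRepresentation`); if `r_{H,θ}` kills `K₂'`, `K₁ ⁄ K₂'` and `ρ ⁄ K₁`, it kills `ρ`.
[cite: BernsteinZelevinskyASENS1977, Prop. 1.9 (a)–(b)] -/
theorem forall_mk_charTwist_eq_zero_of_two_step (K₁ : Subrepresentation ρ) (K₂ : Subrepresentation K₁.toRepresentation)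
    (h₂ : ∀ v, Coinvariants.mk (K₂.toRepresentation.charTwist H θ) v = 0) (h₁₂ : ∀ w, Coinvariants.mk (K₂.quotientRep.charTwist H θ) w = 0)
    (h₁ : ∀ w, Coinvariants.mk (K₁.quotientRep.charTwist H θ) w = 0) (v : V) :
    Coinvariants.mk (ρ.charTwist H θ) v = 0 :=
  forall_mk_charTwist_eq_zero_of_extension ρ K₁ (forall_mk_charTwist_eq_zero_of_extension K₁.toRepresentation K₂ h₂ h₁₂) h₁ v

end General

section Whittaker

variable {R : Type*} [CommRing R] {n : ℕ} {V : Type*} [AddCommGroup V] [Module ℂ V] (π : Representation ℂ (GL (Fin n) R) V) (ψ : AddChar R Circle)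

/-- **`J_ψ(N) = 0 ∧ J_ψ(π ⁄ N) = 0 ⇒ J_ψ(π) = 0`.** [cite: BernsteinZelevinskyASENS1977, Prop. 1.9 (a)–(b)] -/
theorem forall_mk_whittakerTwist_eq_zero_of_extension (N : Subrepresentation π)
    (hN : ∀ v, Coinvariants.mk (whittakerTwist N.toRepresentation ψ) v = 0) (hQ : ∀ w, Coinvariants.mk (whittakerTwist N.quotientRep ψ) w = 0) (v : V) :
    Coinvariants.mk (whittakerTwist π ψ) v = 0 :=
  forall_mk_charTwist_eq_zero_of_extension π N hN hQ v

/-- **Two-step form for `J_ψ`.** [cite: BernsteinZelevinskyASENS1977, Prop. 1.9 (a)–(b)] -/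
theorem forall_mk_whittakerTwist_eq_zero_of_two_step (K₁ : Subrepresentation π) (K₂ : Subrepresentation K₁.toRepresentation)
    (h₂ : ∀ v, Coinvariants.mk (whittakerTwist K₂.toRepresentation ψ) v = 0) (h₁₂ : ∀ w, Coinvariants.mk (whittakerTwist K₂.quotientRep ψ) w = 0)
    (h₁ : ∀ w, Coinvariants.mk (whittakerTwist K₁.quotientRep ψ) w = 0) (v : V) :
    Coinvariants.mk (whittakerTwist π ψ) v = 0 :=
  forall_mk_charTwist_eq_zero_of_two_step π K₁ K₂ h₂ h₁₂ h₁ v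

end Whittaker

end Summit.HodgeConjecture.HodgeConjecture.Cruxes.H413.K2E3TwistedCoinvariantsExtension

end
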